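import Summits.HodgeConjecture.HodgeConjecture.Theorems.MarkmanPartnerTransportPicardThreeK3SquaresKugaSatakeSelfClassMap
import Summits.HodgeConjecture.HodgeConjecture.Theorems.MarkmanPartnerTransportPicardThreeK3SquaresKugaSatakeSelfTranspose
import Summits.HodgeConjecture.HodgeConjecture.Theorems.MarkmanPartnerTransportPicardThreeK3SquaresKugaSatakeSelfDescent
import Literature.AlgebraicGeometry.Motives.HodgeStructureK3RealMultProofs

/-!
# Route MarkmanPartnerTransport · crux `PicardThreeK3Squares` (stmt-HodgeConjecture-19652) —
# a rational Hodge SELF-SIMILITUDE of `T(S)` is algebraic GRANTED the Kuga–Satake statement for `S`,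
# WITHOUT Varesco's theorem (programme «KS-SELF», assembly)

Varesco (Math. Z. 305 (2023), Thm. 5.3 / Cor. 4.6) proves: if the Kuga–Satake correspondences of two
K3 surfaces are algebraic, every Hodge similarity of their transcendental lattices is algebraic; the
tree holds this as the NAMED FACT `Surfaces.Varesco2023_transcendentalHodgeSimilitude_algebraic_of_kugaSatake_K3`,
consumed on the crux-#4 chain only for SELF-similitudes (`…KugaSatakeSimilitude`). Varesco's proof
rests on Lemma 4.4 (`δ ∘ κ^∨ ∘ L^{2N-2} ∘ κ|_T = c · id`), whose "multiple of the identity" half is a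
deformation to a Mumford–Tate-general fibre. THIS FILE proves the self-similitude case from the
Kuga–Satake hypothesis ALONE, replacing the deformation by the SUBFIELD TRICK:

* two presentations `(T, P, ε, j)`, `(T, d·P, ε, j ∘ ψ_T)` of the transcendental part
  (`…TranscendentalPresentation`, `…KugaSatakeSelfPresentation`) and the SAME Kuga–Satake variety with
  `φ`-transported data (`…KugaSatakeSimilarTransport`, `…KugaSatakeSelfClassMap`) give algebraic
  `O₁, O₂ : H²(S) → H²(A × A)` with `O₂ ∘ ψ = O₁` on `T(S)`;
* the Lefschetz–transpose `R = ᵗO₁ ∘ L^{n-2}` makes `Φᵢ = R ∘ Oᵢ` algebraic self-correspondences of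
  `S` with `Φ₂ ∘ ψ = Φ₁` on `T(S)` and `Φ₁ σ ≠ 0` by Hodge–Riemann (`…KugaSatakeSelfTranspose`);
* `transc_of_isAlgebraicCorrespondence` — algebraic self-correspondences preserve `T(S)_ℂ` (transpose +
  Lefschetz `(1,1)`), so `Φ₁, Φ₂, ψ` descend to Hodge endomorphisms `a₁, a₂, g` of the IRREDUCIBLE
  K3-type structure `T(S)_ℚ`, whose endomorphism algebra is a FIELD (the tree's
  `Zarhin1983_endAlg_isField_holds`), with `a₂ g = a₁ ≠ 0`;
* `mem_of_mul_eq_of_isField` — THE SUBFIELD TRICK: the cycle-induced Hodge endomorphisms form a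
  finite-dimensional `ℚ`-subspace `R` closed under products; right multiplication by `a₂ ≠ 0` is
  injective hence surjective on `R`, so `g = a₁ a₂⁻¹ ∈ R`;
* `multiplier_pos` — the multiplier `d` of a self-adjoint self-similitude is POSITIVE (`ψσ = λσ` with
  `λ` real by self-adjointness and `∫ σ ∪ σ̄ ≠ 0`, `d = λ²`);
* `exists_algebraicCorrespondence_eq_of_selfSimilitude_of_kugaSatake` — **THE THEOREM**: for a smooth
  projective surface `S` with `h^{2,0}(S) = 1` whose Kuga–Satake correspondence is algebraic
  (`IsKSCorrespondenceAlgebraicBetti`, HYPOTHESIS) and `ψ ∈ End H²(S(ℂ); ℂ)` rational, type-preserving,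
  cup-self-adjoint, with image cup-orthogonal to `N¹(S)` and `ψ² = d ≠ 0` on `T(S)`, SOME ALGEBRAIC
  SELF-CORRESPONDENCE OF `S` AGREES WITH `ψ` ON `T(S)` — the conclusion of
  `KugaSatakeSimilitude.exists_algebraicCorrespondence_eq_of_selfSimilitude_of_kugaSatake` WITHOUT its
  hypothesis `hVar`, and for every surface with `h^{2,0} = 1` (not only K3).

CONDITIONAL only on the Kuga–Satake hypothesis for `S` (open in print for a general K3 surface); no
named fact, no definition, no sorry; nothing here says HC or the crux is proved. Prover seat
hodge-nonav-19652-p1 (gen 14), `--supports stmt-HodgeConjecture-19652`.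

References: M. Varesco, *Hodge similarities, algebraic classes, and Kuga–Satake varieties*, Math. Z.
305 (2023), §0.3, Lemma 4.4, Thm. 4.5, Cor. 4.6, Thm. 5.3; D. Huybrechts, *Motives of isogenous K3
surfaces*, Comment. Math. Helv. 94 (2019), Rem. 3.3 (the subfield of algebraic endomorphisms);
Yu. G. Zarhin, J. reine angew. Math. 341 (1983), Thm. 1.5.1; B. van Geemen (2000), §10.2.
-/

set_option linter.dupNamespace false

noncomputable section

namespace Summit.HodgeConjecture.HodgeConjecture.Theorems.MarkmanPartnerTransport.KugaSatakeSelf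

open scoped TensorProduct
open CategoryTheory MonoidalCategory Literature.AlgebraicGeometry Literature.AlgebraicGeometry.Motives
open Literature.AlgebraicGeometry.HodgeTheory Literature.AlgebraicTopology.SingularHomology
open Literature.AlgebraicGeometry.Motives.HodgeStructure
open Literature.AlgebraicGeometry.Surfaces
open Summit.HodgeConjecture.HodgeConjecture.Theorems.OddPrimeSquares
open Summit.HodgeConjecture.HodgeConjecture.Theorems.MarkmanPartnerTransport.TranscendentalPresentation
open Summit.HodgeConjecture.HodgeConjecture.Ring2.AbelianAll

variable {S : SchemeOver ℂ}

/-- `H²_B(S)`: the weight-two `ℚ`-Hodge structure on `H²(S(ℂ); ℚ)` of the real Hodge model of `S`. -/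
local notation3 "H²[" hS "]" =>
  bettiTwoHodgeStructure hS (BettiUniverse.realHodgeModel exists_isReal_hodgeModel_holds hS)
    (BettiUniverse.realHodgeModel_isHodgeSymmetric exists_isReal_hodgeModel_holds hS)

/-- `T(S)_ℚ = Hdg¹^⊥ ⊆ H²(S(ℂ); ℚ)`. -/
local notation3 "T[" hS "]" =>
  transcendentalLatticeBetti hS (BettiUniverse.realHodgeModel exists_isReal_hodgeModel_holds hS)
    (BettiUniverse.realHodgeModel_isHodgeSymmetric exists_isReal_hodgeModel_holds hS)

/-- `Θ : ℂ ⊗_ℚ H²(S(ℂ); ℚ) → H²(S(ℂ); ℂ)`. -/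
local notation3 "Θ[" S "]" => ofRatClassBaseChange (Motives.ComplexPoints S) (2 * 1)

/-- `ι : H²(S(ℂ); ℚ) → H²(S(ℂ); ℂ)`, the rational lattice. -/
local notation3 "ι[" S "]" => ofRatClass (Motives.ComplexPoints S) (2 * 1)

/-- `Transc[S, y]`: `y` is cup-orthogonal to `N¹(S) = algebraicClasses S 1`. Local notation only. -/
local notation3 (prettyPrint := false) "Transc[" S ", " y "]" =>
  (∀ d ∈ algebraicClasses S 1, cupProduct (rfl : 2 * 1 + 2 * 1 = 2 * 2) y d = 0)

/-! ### §5 The theorem -/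

/-- **A RATIONAL HODGE SELF-SIMILITUDE OF `T(S)` IS ALGEBRAIC ON `T(S)`, GRANTED THE KUGA–SATAKE
STATEMENT FOR `S` — WITHOUT VARESCO'S THEOREM.** Let `S` be a smooth projective surface whose
`(2,0)`-classes form a line `ℂσ`, `σ ≠ 0` (`h^{2,0}(S) = 1`), whose Kuga–Satake correspondence is
algebraic (`IsKSCorrespondenceAlgebraicBetti`, HYPOTHESIS, open in print for a general K3 surface), and
let `ψ ∈ End H²(S(ℂ); ℂ)` be rational, Hodge-type preserving, cup-self-adjoint, with image
cup-orthogonal to `N¹(S)` and `ψ(ψ y) = d y` on `T(S) = {y | y ⊥ N¹(S)}`, `d ≠ 0`. Then some `ℂ`-linear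
`Φ` INDUCED BY AN ALGEBRAIC CYCLE on `S × S` agrees with `ψ` on `T(S)`. Proof: §1–§4 and the files
`…TranscendentalPresentation`, `…KugaSatakeSimilarTransport`, `…KugaSatakeSelfPresentation`,
`…KugaSatakeSelfClassMap`, `…KugaSatakeSelfTranspose` (two presentations, one Kuga–Satake variety,
Lefschetz–transpose, Hodge–Riemann, Zarhin's field, subfield trick). This is the conclusion of
`KugaSatakeSimilitude.exists_algebraicCorrespondence_eq_of_selfSimilitude_of_kugaSatake` with the
named-fact hypothesis `hVar` REMOVED. [cite: Varesco2023, Thm. 5.3, Cor. 4.6, Thm. 4.5 and §0.3]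
[cite: Floccari2026, §3.3 Rem. 3.4] [cite: Zarhin1983HodgeGroupsK3, Thm. 1.5.1] -/
theorem exists_algebraicCorrespondence_eq_of_selfSimilitude_of_kugaSatake (hS : IsSmoothProjective 2 S)
    {σ : complexBetti S (2 * 1)} (hσ : IsOfHodgeType 2 S (2 * 1) 2 0 σ) (hσ0 : σ ≠ 0)
    (hline : ∀ c : complexBetti S (2 * 1), IsOfHodgeType 2 S (2 * 1) 2 0 c → ∃ t : ℂ, c = t • σ)
    (hKS : IsKSCorrespondenceAlgebraicBetti hS)
    (ψ : complexBetti S (2 * 1) →ₗ[ℂ] complexBetti S (2 * 1))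
    (h1 : ∀ y, IsRationalClass y → IsRationalClass (ψ y))
    (h2 : ∀ (i j : ℕ) y, IsOfHodgeType 2 S (2 * 1) i j y → IsOfHodgeType 2 S (2 * 1) i j (ψ y))
    (h4 : ∀ y : complexBetti S (2 * 1), Transc[S, ψ y])
    (h5 : ∀ y w : complexBetti S (2 * 1),
      cupProduct (rfl : 2 * 1 + 2 * 1 = 2 * 2) (ψ y) w = cupProduct (rfl : 2 * 1 + 2 * 1 = 2 * 2) y (ψ w))
    (d : ℚ) (hd : d ≠ 0) (hψψ : ∀ y : complexBetti S (2 * 1), Transc[S, y] → ψ (ψ y) = (d : ℂ) • y) :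
    ∃ Φ : complexBetti S (2 * 1) →ₗ[ℂ] complexBetti S (2 * 1), IsAlgebraicCorrespondence 2 2 S S Φ ∧
      ∀ y : complexBetti S (2 * 1), Transc[S, y] → Φ y = ψ y := by
  classical
  haveI : Module.Finite ℚ (bettiCohomology S (2 * 1)) := BettiUniverse.finite hS (2 * 1)
  -- positivity of the multiplier
  have hdpos : 0 < d := multiplier_pos hS hσ hσ0 hline ψ h1 h2 h5 hd (hψψ σ (transc_of_twoZero hS hσ))
  -- F1: the presentation
  obtain ⟨T, P, ε, hT, hirr, hK3, h20, hj⟩ := exists_isTranscendentalPartBetti hS hσ hσ0 hline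
  haveI : Module.Finite ℚ T.toSubmodule := Module.Finite.of_injective T.toSubmodule.subtype
    T.toSubmodule.injective_subtype
  -- F2b: `ψ_T` and the second presentation
  obtain ⟨ψT, hψT⟩ := exists_hom_transcendental hS T hT ψ h1 h2 h4
  have hgg : ∀ t, ψT.toLinearMap (ψT.toLinearMap t) = d • t := hom_transcendental_sq hT hψT hψψ
  have hga := cupPairingBetti_hom_transcendental (hS := hS) hψT h5
  have hjg : IsTranscendentalPartBetti hS _ _ T.toHodgeStructure (P.smul d hdpos) ε (T.subtypeHom.comp ψT) :=
    isTranscendentalPartBetti_smul_comp hS hj ψT hdpos hgg hga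
  -- F2c: the two correspondences
  obtain ⟨A, μ, O₁, O₂, hμ, hO₁, hO₂, hO₁j, hO₂j⟩ :=
    exists_two_correspondences_of_kugaSatake hS hKS hj hK3 ψT hdpos hjg
  have hA : IsSmoothProjective A.dim A.X := AbelianVariety.isSmoothProjective_holds
  have hY : IsSmoothProjective (A.dim + A.dim) (A.X ⊗ A.X) := hA.tensor_holds hA
  have hn : 2 ≤ A.dim + A.dim := by
    have h := IsAlgebraicCorrespondence.le_two_mul hO₁
    omega
  -- F3: the Lefschetz–transpose
  obtain ⟨R, hΦ₁, hΦ₂, hne⟩ := exists_lefschetzTranspose hS hY hn hO₁ hO₂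
  -- `O₁` on `Θ(T_ℂ)`: `O₁ (Θ sub x) = Θ_Y (μ_ℂ x)`
  have hO₁x : ∀ x : ℂ ⊗[ℚ] T.toSubmodule, O₁ (Θ[S] (T.toSubmodule.subtype.baseChange ℂ x)) =
      ofRatClassBaseChange (Motives.ComplexPoints (A.X ⊗ A.X)) 2 (μ.baseChange ℂ x) := by
    intro x
    induction x using TensorProduct.induction_on with
    | zero => simp only [map_zero]
    | tmul c t =>
      rw [LinearMap.baseChange_tmul, Submodule.subtype_apply, ofRatClassBaseChange_tmul, map_smul,
        LinearMap.baseChange_tmul, ofRatClassBaseChange_tmul]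
      exact congrArg _ (hO₁j t)
    | add x y hx hy => simp only [map_add, hx, hy]
  -- `σ = Θ(sub x₀)`
  obtain ⟨x₀, hx₀⟩ := exists_baseChange_eq_of_transc hS T hT (transc_of_twoZero hS hσ)
  have hx₀0 : x₀ ≠ 0 := by rintro rfl; exact hσ0 (by rw [← hx₀, map_zero, map_zero])
  -- `O₁ σ ≠ 0` and `O₁ σ̄ = \overline{O₁ σ}`
  have hμC : Function.Injective (μ.baseChange ℂ) := by
    rw [LinearMap.baseChange_eq_ltensor]
    exact Module.Flat.lTensor_preserves_injective_linearMap _ hμ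
  have hO₁σ0 : O₁ σ ≠ 0 := by
    rw [← hx₀, hO₁x]
    intro h0
    exact hx₀0 (hμC (ofRatClassBaseChange_injective _ _ (by rw [h0, map_zero, map_zero])))
  have hO₁conj : O₁ (conjClass _ (2 * 1) σ) = conjClass _ 2 (O₁ σ) := by
    rw [← hx₀, ← ofRatClassBaseChange_conj_eq hS, conj_baseChange, hO₁x, hO₁x, ← conj_baseChange]
    exact KaehlerRationalDatum.ofRatClassBaseChange_conj hY
      (BettiUniverse.realHodgeModel exists_isReal_hodgeModel_holds hY) _
  have hΦ₁σ : (R ∘ₗ O₁) σ ≠ 0 :=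
    hne σ (isOfHodgeType_two_zero_of_isAlgebraicCorrespondence hY hS hO₁ hσ) hO₁σ0 hO₁conj
  -- `Φ₂ ∘ ψ = Φ₁` on `T(S)_ℚ`
  have hrel : ∀ t : T.toSubmodule, (R ∘ₗ O₂) (ψ (ι[S] (t : bettiCohomology S (2 * 1)))) =
      (R ∘ₗ O₁) (ι[S] (t : bettiCohomology S (2 * 1))) := by
    intro t
    rw [LinearMap.comp_apply, LinearMap.comp_apply, ← hψT]
    exact congrArg R ((hO₂j t).trans (hO₁j t).symm)
  -- the cycle-induced Hodge endomorphisms of `T` (induced on `T(S)_ℚ` by SOME `ℂ`-algebraic correspondence)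
  let Rs : Submodule ℚ (Module.End ℚ T.toSubmodule) :=
    { carrier := {a | a ∈ T.toHodgeStructure.endAlg ∧
        ∃ f : complexBetti S (2 * 1) →ₗ[ℂ] complexBetti S (2 * 1), IsAlgebraicCorrespondence 2 2 S S f ∧
          ∀ t : T.toSubmodule, f (ι[S] (t : bettiCohomology S (2 * 1))) =
            ι[S] ((a t : T.toSubmodule) : bettiCohomology S (2 * 1))}
      add_mem' := by
        rintro a b ⟨haE, f, hf, hfa⟩ ⟨hbE, f', hf', hfb⟩
        refine ⟨add_mem haE hbE, f + f', IsAlgebraicCorrespondence.add hS hS hf hf', fun t => ?_⟩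
        rw [LinearMap.add_apply, hfa, hfb, LinearMap.add_apply, Submodule.coe_add, map_add]
      zero_mem' := by
        refine ⟨zero_mem _, 0, isAlgebraicCorrespondence_zero hS hS (e := 2) rfl (by norm_num), fun t => ?_⟩
        rw [LinearMap.zero_apply, LinearMap.zero_apply, Submodule.coe_zero, map_zero]
      smul_mem' := by
        rintro c a ⟨haE, f, hf, hfa⟩
        refine ⟨Subalgebra.smul_mem _ haE c, (c : ℂ) • f, IsAlgebraicCorrespondence.smul hS hS hf _, fun t => ?_⟩
        rw [LinearMap.smul_apply, hfa, LinearMap.smul_apply, Submodule.coe_smul, Motives.ofRatClass_smul] }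
  have hRsE : ∀ a ∈ Rs, a ∈ T.toHodgeStructure.endAlg := fun a ha => ha.1
  have hRsmul : ∀ a ∈ Rs, ∀ b ∈ Rs, a * b ∈ Rs := by
    rintro a ⟨haE, f, hf, hfa⟩ b ⟨hbE, f', hf', hfb⟩
    refine ⟨mul_mem haE hbE, f ∘ₗ f', IsAlgebraicCorrespondence.comp hS hS hS hf' hf (by norm_num), fun t => ?_⟩
    rw [LinearMap.comp_apply, hfb, hfa, Module.End.mul_apply]
  have hgE : ψT.toLinearMap ∈ T.toHodgeStructure.endAlg := ψT.map_F_le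
  -- `Θ` as an equivalence, and the retraction `(r ⊗ 1) ∘ Θ⁻¹`
  let Θe : (ℂ ⊗[ℚ] bettiCohomology S (2 * 1)) ≃ₗ[ℂ] complexBetti S (2 * 1) :=
    LinearEquiv.ofBijective (Θ[S]) ⟨ofRatClassBaseChange_injective _ _, ofRatClassBaseChange_surjective hS (2 * 1)⟩
  have hΘe : ∀ x, Θe x = Θ[S] x := fun _ => rfl
  have hΘe_symm : ∀ (c : ℂ) (w : bettiCohomology S (2 * 1)), Θe.symm (c • ι[S] w) = c ⊗ₜ[ℚ] w := by
    intro c w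
    apply Θe.injective
    rw [LinearEquiv.apply_symm_apply, hΘe, ofRatClassBaseChange_tmul]
  -- DESCENT: `(r ⊗ 1) Θ⁻¹ f ι` is a cycle-induced Hodge endomorphism of `T`, for every `ℂ`-algebraic `f`
  have hdesc : ∀ (r : ℂ →ₗ[ℚ] ℚ) {f : complexBetti S (2 * 1) →ₗ[ℂ] complexBetti S (2 * 1)},
      IsAlgebraicCorrespondence 2 2 S S f → ∃ a ∈ Rs, ∀ t : T.toSubmodule,
        TensorProduct.lid ℚ _ (r.rTensor _ (Θe.symm (f (ι[S] (t : bettiCohomology S (2 * 1)))))) =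
          ((a t : T.toSubmodule) : bettiCohomology S (2 * 1)) := by
    intro r f hf
    obtain ⟨e, hab, γ, hγ, rfl⟩ := IsAlgebraicCorrespondence.exists_eq_corrAction hS hS hf
    suffices h : ∀ c : ℂ, ∃ a ∈ Rs, ∀ t : T.toSubmodule,
        TensorProduct.lid ℚ _ (r.rTensor _ (Θe.symm
          (c • corrAction complexOrientationFamily hS hS hab γ (ι[S] (t : bettiCohomology S (2 * 1)))))) =
          ((a t : T.toSubmodule) : bettiCohomology S (2 * 1)) by
      obtain ⟨a, ha, h1⟩ := h 1
      exact ⟨a, ha, fun t => by rw [← h1 t, one_smul]⟩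
    have hγ' := (le_of_eq (supportedClasses_eq_span_isRationalClass (hS.tensor_holds hS) (2 * e) e)) hγ
    clear hf hγ
    induction hγ' using Submodule.span_induction with
    | mem γ hγQ =>
      intro c
      obtain ⟨a, haE, ha⟩ := exists_endAlg_of_isRationalClass hS T hT hab hγQ.2 hγQ.1
      have haR : a ∈ Rs :=
        ⟨haE, _, isAlgebraicCorrespondence_corrAction_complex hS hS hab (by norm_num) hγQ.2, ha⟩
      refine ⟨r c • a, Rs.smul_mem _ haR, fun t => ?_⟩
      rw [ha t, hΘe_symm, lid_rTensor_tmul, LinearMap.smul_apply, Submodule.coe_smul]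
    | zero =>
      intro c
      refine ⟨0, Rs.zero_mem, fun t => ?_⟩
      rw [map_zero, LinearMap.zero_apply, smul_zero, map_zero, map_zero, map_zero, LinearMap.zero_apply,
        Submodule.coe_zero]
    | add γ γ' _ _ h h' =>
      intro c
      obtain ⟨a, ha, hat⟩ := h c
      obtain ⟨a', ha', hat'⟩ := h' c
      refine ⟨a + a', Rs.add_mem ha ha', fun t => ?_⟩
      rw [map_add, LinearMap.add_apply, smul_add, map_add, map_add, map_add, hat, hat', LinearMap.add_apply,
        Submodule.coe_add]
    | smul c' γ _ h =>
      intro c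
      obtain ⟨a, ha, hat⟩ := h (c * c')
      refine ⟨a, ha, fun t => ?_⟩
      rw [(corrAction complexOrientationFamily hS hS hab).map_smul, LinearMap.smul_apply, smul_smul]
      exact hat t
  -- a rational vector of `T` where `Φ₁` does not vanish
  have hzero_or : ∃ t₀ : T.toSubmodule, (R ∘ₗ O₁) (ι[S] (t₀ : bettiCohomology S (2 * 1))) ≠ 0 := by
    by_contra hall
    push Not at hall
    have hzero : ∀ x : ℂ ⊗[ℚ] T.toSubmodule, (R ∘ₗ O₁) (Θ[S] (T.toSubmodule.subtype.baseChange ℂ x)) = 0 := by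
      intro x
      induction x using TensorProduct.induction_on with
      | zero => rw [map_zero, map_zero, map_zero]
      | tmul c t =>
        rw [LinearMap.baseChange_tmul, Submodule.subtype_apply, ofRatClassBaseChange_tmul, map_smul, hall t,
          smul_zero]
      | add x y hx hy => rw [map_add, map_add, map_add, hx, hy, add_zero]
    apply hΦ₁σ
    rw [← hx₀]
    exact hzero x₀
  obtain ⟨t₀, ht₀⟩ := hzero_or
  have hξ : Θe.symm ((R ∘ₗ O₁) (ι[S] (t₀ : bettiCohomology S (2 * 1)))) ≠ 0 := by
    intro h0
    apply ht₀
    have h := congrArg Θe h0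
    rwa [LinearEquiv.apply_symm_apply, map_zero] at h
  obtain ⟨r, hr⟩ := exists_rat_retraction_ne_zero hξ
  -- the descended endomorphisms `a₁, a₂ ∈ Rs` with `a₂ g = a₁ ≠ 0`
  obtain ⟨a₁, ha₁R, ha₁⟩ := hdesc r hΦ₁
  obtain ⟨a₂, ha₂R, ha₂⟩ := hdesc r hΦ₂
  have ha₁0 : a₁ ≠ 0 := by
    intro h0
    apply hr
    rw [ha₁ t₀, h0, LinearMap.zero_apply, Submodule.coe_zero]
  have hmulrel : a₂ * ψT.toLinearMap = a₁ := by
    refine LinearMap.ext fun t => Subtype.ext ?_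
    rw [Module.End.mul_apply, ← ha₂, ← ha₁, hψT, hrel t]
  -- Zarhin: `End_Hdg(T)` is a field; the subfield trick
  obtain ⟨hField, -⟩ := Zarhin1983_endAlg_isField_holds T.toHodgeStructure hirr hK3
  have hgR : ψT.toLinearMap ∈ Rs :=
    mem_of_mul_eq_of_isField hField Rs hRsE hRsmul ha₁R ha₂R hgE ha₁0 hmulrel
  obtain ⟨-, f, hf, hfψ⟩ := hgR
  refine ⟨f, hf, fun y hy => ?_⟩
  obtain ⟨x, rfl⟩ := exists_baseChange_eq_of_transc hS T hT hy
  clear hy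
  induction x using TensorProduct.induction_on with
  | zero => rw [map_zero, map_zero, map_zero, map_zero]
  | tmul c t =>
    rw [LinearMap.baseChange_tmul, Submodule.subtype_apply, ofRatClassBaseChange_tmul, map_smul, map_smul,
      hfψ t, hψT t]
  | add x y hx hy => rw [map_add, map_add, map_add, map_add, hx, hy]

end Summit.HodgeConjecture.HodgeConjecture.Theorems.MarkmanPartnerTransport.KugaSatakeSelf

end
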